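import Mathlib
import HarnessLib
import Summits.HubbardSuperconductivity.HubbardSuperconductivity.Theorems.KLProgrammeC4aPPKernelFarSFlatnessRow
import Summits.HubbardSuperconductivity.HubbardSuperconductivity.Theorems.KLProgrammeC4aPPKernelFarSNeg
import Summits.HubbardSuperconductivity.HubbardSuperconductivity.Theorems.KLProgrammeC4aPPKernelFamilyRows
import Summits.HubbardSuperconductivity.HubbardSuperconductivity.Theorems.KLProgrammeC4aPPKernelSplitProfile

/-!
# Route `KLProgramme` — crux C4a, S3 brick (B4) «(B4)-UMK1», «(U1)-FARS-ROWS» part 6: THE ONE-CALL BUNDLE for the smooth far piece — for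
# `K e u := ppFarKernelS β Λ κ lo e u / C`, the thirteen kernel rows of `…C4aFoldBoxLawRows.foldBox_law_rows'` in its binder order and shapes

Cell `gate-hubbard-kl`, seat hubbard-kl-k3c3-p1 (g17; row «δμ-flow with klAngularMean constant piece»).  The all-smooth partition
`P = A_s + swap A_s + M_s` (`ppTrueKernel_eq_farS_add_swap_add_midS`, p704596) needs ONE ratio `r̃ = m̃ₑ/(m̃ₑ+m̃ᵤ)`; this file is the (C)-closer's one-call kernel
input for the primed near-caustic box / generic arc / loop circle on the `A_s` piece (companion of `ppMidKernelS_rows` for `M_s`, p709963, and of g16's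
`ppFamilyKernel_rows` for the max-floor family).  Use:
`obtain ⟨hKd, hK2d, hK0, hK1, hK2, hsupp, hKc, hflat, hKn1, hρ0, hρc, hρtail, hKs1⟩ := ppFarKernelS_rows … hC0 hC1 hC2 hCs hlohi hwc hw0 hwW hW' hwL`.
* §1 **`ppFarKernelS_rows`** — rows `hKd, hK2d, hK0, hK1, hK2, hsupp (q_s = (1−t₁)/t₁), hKc, hflat (Afl = W·X_A/C, Bfl = W′C₁ᴬt₁²/((1−t₁)²C), Dfl = hi/t₁), hKn1, hρ0, hρc,
  hρtail (the family majorant `ρᶠ/C`, `Mρᶠ/C` verbatim), hKs1`; **`ppFarKernelS_consts_nonneg`** (`0 ≤ Afl, Bfl, Mρ`);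
* §2 one-call preliminaries: **`farSRow_hK0s`** (the arc laws' strip VALUE row, `8κ₀ ≤ C`), **`ppSplit_rowConstsFarS`** (row constants at the concrete split profile
  `κ₀ = 1, κ₁ = 6/t₁, κ₂ = 8388608/t₁²`: `Cᴬ(B₁,B₂,B₃,t₁) = C₀ᴬ + C₁ᴬ + C₂ᴬ + Cˢ` dominates each).
Constants: `C₀ᴬ = κ₀(12B₁+9)`, `C₁ᴬ = κ₀(64B₂+108B₁+145) + κ₁(12B₁+9)`, `C₂ᴬ = κ₀(256B₃+800B₂+2592B₁+1630) + 2κ₁(64B₂+108B₁+145) + (12B₁+9)(κ₂+3κ₁)`,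
`Cˢ = κ₀(128B₁+72) + 8κ₁`, `X_A = 4C₁ᴬ(Λ/lo)² + κ₀((6B₁+5/2)(Λ/lo) + (Λ/lo)/(2(1−t₁)) + 6/(β·lo) + 1) + κ₁(1/(2(1−t₁)) + t₁/(1−t₁))`.
Pure real analysis; nothing asserts (C), K3, the window or superconductivity.
References: BGM 2006 §2.4 (2.36) [cite: BenfattoGiulianiMastropietro2006]; FST II CPAM 51 (1998) §3 [cite: FeldmanSalmhoferTrubowitz1998].
-/

noncomputable section

namespace Summit.HubbardSuperconductivity.HubbardSuperconductivity.Theorems.C4a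

set_option linter.dupNamespace false -- summit = problem name (single-conjunct summit), D-0017

open Real Filter Set MeasureTheory intervalIntegral
open scoped Topology Interval
open Literature.MathematicalPhysics.QuantumLattice Literature.Analysis.SpecialFunctions

section Bundle

variable {β Λ : ℝ} (hβ : 0 < β) (hΛ : 0 < Λ) {B₁ B₂ B₃ : ℝ} (hB₁ : ∀ x, |deriv salmhoferCutoff x| ≤ B₁) (hB₂ : ∀ x, |deriv (deriv salmhoferCutoff) x| ≤ B₂)
  (hB₃ : ∀ x, |deriv (deriv (deriv salmhoferCutoff)) x| ≤ B₃)
  {κ κ' κ'' : ℝ → ℝ} (hκ : ∀ t, HasDerivAt κ (κ' t) t) (hκ' : ∀ t, HasDerivAt κ' (κ'' t) t) (hκ''c : Continuous κ'')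
  {κ₀ κ₁ κ₂ : ℝ} (hκb : ∀ t ∈ Icc 0 1, |κ t| ≤ κ₀) (hκ'b : ∀ t ∈ Icc 0 1, |κ' t| ≤ κ₁) (hκ''b : ∀ t ∈ Icc 0 1, |κ'' t| ≤ κ₂)
  {t₁ : ℝ} (ht₀ : 0 < t₁) (ht25 : t₁ ≤ 2 / 5)
  (hκs : ∀ t, t₁ ≤ t → κ t = 0) (hκ's : ∀ t, t₁ ≤ t → κ' t = 0) (hκ''s : ∀ t, t₁ ≤ t → κ'' t = 0)
  {lo hi C : ℝ} (hlo : 0 < lo) (hloΛ : lo ≤ Λ) (hC : 0 < C)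

set_option maxHeartbeats 400000 in
include hβ hΛ hB₁ hB₂ hB₃ hκ hκ' hκ''c hκb hκ'b hκ''b ht₀ ht25 hκs hκ's hκ''s hlo hloΛ hC in
/-- **THE THIRTEEN KERNEL ROWS OF `foldBox_law_rows'` FOR `K := ppFarKernelS/C`** in its binder order and shapes (`hKd, hK2d, hK0, hK1, hK2, hsupp, hKc, hflat, hKn1,
hρ0, hρc, hρtail, hKs1`), with `q_s := (1−t₁)/t₁`, `Dfl := hi/t₁`, `Afl := W·X_A/C`, `Bfl := W′C₁ᴬt₁²/((1−t₁)²C)`, `ρm := ρᶠ/C`, `Mρ := Mρᶠ/C`; normalisation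
`C₀ᴬ, C₁ᴬ, C₂ᴬ, Cˢ ≤ C`; weight `wt` continuous and `0 ≤ wt ≤ W` on `[−hi,hi]`, `|wt e − wt lo| ≤ W′(e−lo)` on `[lo,hi]`.
[cite: BenfattoGiulianiMastropietro2006, §2.4 (2.36)] -/
theorem ppFarKernelS_rows (hC0 : κ₀ * (12 * B₁ + 9) ≤ C) (hC1 : κ₀ * (64 * B₂ + 108 * B₁ + 145) + κ₁ * (12 * B₁ + 9) ≤ C)
    (hC2 : κ₀ * (256 * B₃ + 800 * B₂ + 2592 * B₁ + 1630) + 2 * κ₁ * (64 * B₂ + 108 * B₁ + 145) + (12 * B₁ + 9) * (κ₂ + 3 * κ₁) ≤ C)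
    (hCs : κ₀ * (128 * B₁ + 72) + 8 * κ₁ ≤ C) (hlohi : lo ≤ hi) {wt : ℝ → ℝ} {W W' : ℝ} (hwc : ContinuousOn wt (Icc (-hi) hi))
    (hw0 : ∀ e ∈ Icc (-hi) hi, 0 ≤ wt e) (hwW : ∀ e ∈ Icc (-hi) hi, wt e ≤ W) (hW' : 0 ≤ W') (hwL : ∀ e ∈ Icc lo hi, |wt e - wt lo| ≤ W' * (e - lo)) :
    (∀ e ∈ Icc (-hi) hi, e ≠ 0 → ContDiff ℝ 1 (fun v : ℝ => ppFarKernelS β Λ κ lo e v / C)) ∧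
    (∀ e ∈ Icc lo hi, ContDiff ℝ 2 (fun v : ℝ => ppFarKernelS β Λ κ lo e v / C)) ∧
    (∀ e ∈ Icc (-hi) hi, e ≠ 0 → ∀ u, |ppFarKernelS β Λ κ lo e u / C| ≤ (max |e| |u|)⁻¹) ∧
    (∀ e ∈ Icc (-hi) hi, e ≠ 0 → ∀ u, |deriv (fun v : ℝ => ppFarKernelS β Λ κ lo e v / C) u| ≤ (max |e| |u|)⁻¹ ^ 2) ∧
    (∀ e ∈ Icc lo hi, ∀ u, |iteratedDeriv 2 (fun v : ℝ => ppFarKernelS β Λ κ lo e v / C) u| ≤ (max e |u|)⁻¹ ^ 3) ∧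
    (∀ e ∈ Icc lo hi, ∀ u, |u| ≤ (1 - t₁) / t₁ * e → deriv (fun v : ℝ => ppFarKernelS β Λ κ lo e v / C) u = 0) ∧
    (Continuous fun p : ℝ × ℝ => deriv (fun v : ℝ => ppFarKernelS β Λ κ lo p.1 v / C) p.2) ∧
    (∀ D : ℝ, 0 < D → D ≤ hi / t₁ → |∫ e in lo..hi, wt e * deriv (fun v : ℝ => ppFarKernelS β Λ κ lo e v / C) (D - e)| ≤
      W * (4 * (κ₀ * (64 * B₂ + 108 * B₁ + 145) + κ₁ * (12 * B₁ + 9)) * (Λ / lo) ^ 2 +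
            (κ₀ * ((6 * B₁ + 5 / 2) * (Λ / lo) + Λ / lo / (2 * (1 - t₁)) + 6 / (β * lo) + 1) + κ₁ * (1 / (2 * (1 - t₁)) + t₁ / (1 - t₁)))) / C *
          (lo / (max D lo) ^ 2) +
        W' * (κ₀ * (64 * B₂ + 108 * B₁ + 145) + κ₁ * (12 * B₁ + 9)) * t₁ ^ 2 / (1 - t₁) ^ 2 / C) ∧
    (∀ s ∈ Icc lo hi, ∀ u, s / 2 ≤ u → |deriv (fun v : ℝ => ppFarKernelS β Λ κ lo (-s) v / C) u| ≤
      (64 * (κ₀ * (64 * B₂ + 120 * B₁ + 154) + κ₁ * (12 * B₁ + 9)) * Λ ^ 3 / (s + 2 * Λ) ^ 3 +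
          (κ₀ * ((β * lo) ^ 2 + 2) + κ₁ * (β * lo + 1)) * Real.exp (-(β / 2 * s))) / C * ((max (u - s) lo)⁻¹ ^ 2)) ∧
    (∀ s ∈ Icc lo hi, 0 ≤ (64 * (κ₀ * (64 * B₂ + 120 * B₁ + 154) + κ₁ * (12 * B₁ + 9)) * Λ ^ 3 / (s + 2 * Λ) ^ 3 +
          (κ₀ * ((β * lo) ^ 2 + 2) + κ₁ * (β * lo + 1)) * Real.exp (-(β / 2 * s))) / C) ∧
    (ContinuousOn (fun s : ℝ => (64 * (κ₀ * (64 * B₂ + 120 * B₁ + 154) + κ₁ * (12 * B₁ + 9)) * Λ ^ 3 / (s + 2 * Λ) ^ 3 +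
          (κ₀ * ((β * lo) ^ 2 + 2) + κ₁ * (β * lo + 1)) * Real.exp (-(β / 2 * s))) / C) (Icc lo hi)) ∧
    (∀ a ∈ Icc lo hi, ∫ s in a..hi, (64 * (κ₀ * (64 * B₂ + 120 * B₁ + 154) + κ₁ * (12 * B₁ + 9)) * Λ ^ 3 / (s + 2 * Λ) ^ 3 +
          (κ₀ * ((β * lo) ^ 2 + 2) + κ₁ * (β * lo + 1)) * Real.exp (-(β / 2 * s))) / C ≤
      (32 * (κ₀ * (64 * B₂ + 120 * B₁ + 154) + κ₁ * (12 * B₁ + 9)) * (Λ / lo) ^ 3 +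
          32 * (κ₀ * ((β * lo) ^ 2 + 2) + κ₁ * (β * lo + 1)) / (β * lo) ^ 3) / C * (lo * (lo / a) ^ 2)) ∧
    (∀ e ∈ Icc (-lo) lo, ∀ u, |deriv (fun v : ℝ => ppFarKernelS β Λ κ lo e v / C) u| ≤ (max lo |u|)⁻¹ ^ 2) := by
  have hB10 : 0 ≤ B₁ := salmhoferB₁_nonneg hB₁
  have hB20 : 0 ≤ B₂ := (abs_nonneg _).trans (hB₂ 0)
  have hκ₀ : 0 ≤ κ₀ := (abs_nonneg _).trans (hκb 0 (left_mem_Icc.2 zero_le_one))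
  have hκ₁ : 0 ≤ κ₁ := (abs_nonneg _).trans (hκ'b 0 (left_mem_Icc.2 zero_le_one))
  have hκ'c : Continuous κ' := continuous_iff_continuousAt.2 fun t => (hκ' t).continuousAt
  have hsub : Icc lo hi ⊆ Icc (-hi) hi := Icc_subset_Icc (by linarith only [hlo, hlohi]) le_rfl
  have hwc' : ContinuousOn wt (Icc lo hi) := hwc.mono hsub
  have hwW' : ∀ e ∈ Icc lo hi, |wt e| ≤ W := fun e he => by
    rw [abs_of_nonneg (hw0 e (hsub he))]; exact hwW e (hsub he)
  refine ⟨fun e _ _ => ((contDiff_two_ppFarKernelS_u hβ hΛ hB₁ hB₂ hκ hκ' hκ''c hlo e).of_le (by norm_num)).div_const C,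
    fun e _ => (contDiff_two_ppFarKernelS_u hβ hΛ hB₁ hB₂ hκ hκ' hκ''c hlo e).div_const C,
    fun e _ he u => abs_div_le_of_le (abs_ppFarKernelS_le_inv_max hβ hΛ hB₁ hlo hκb he u).1 hC0 hC (by positivity),
    fun e _ he u => ?_, fun e he u => ?_, fun e he u hu => ?_, ?_, fun D hD hDhi => ?_, fun s hs u hu => ?_,
    familyRow_hρ0 hβ hΛ hC hB10 hB20 hκ₀ hκ₁ hlo,
    familyRow_hρc (β := β) (B₁ := B₁) (B₂ := B₂) (κ₀ := κ₀) (κ₁ := κ₁) (C := C) hΛ hlo,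
    familyRow_hρtail hβ hΛ hC hB10 hB20 hκ₀ hκ₁ hlo, fun e he u => ?_⟩
  · rw [deriv_div_const]
    exact abs_div_le_of_le (abs_deriv_ppFarKernelS_le hβ hΛ hB₁ hB₂ hκ hκb hκ'b ht₀ ht25 hκs hκ's hκ''s hlo he u) hC1 hC (by positivity)
  · rw [iteratedDeriv_div_const]
    have he0 : 0 < e := hlo.trans_le he.1
    exact abs_div_le_of_le (abs_iteratedDeriv_two_ppFarKernelS_le hβ hΛ hB₁ hB₂ hB₃ hκ hκ' hκb hκ'b hκ''b ht₀ ht25 hκs hκ's hκ''s hlo he0 u) hC2 hC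
      (by positivity)
  · rw [deriv_div_const, deriv_ppFarKernelS_eq_zero_of_abs_le hβ hΛ hB₁ hκ ht₀ ht25 hκs hκ's hκ''s hlo (hlo.trans_le he.1) hu, zero_div]
  · have h : (fun p : ℝ × ℝ => deriv (fun v : ℝ => ppFarKernelS β Λ κ lo p.1 v / C) p.2) =
        fun p => deriv (fun v : ℝ => ppFarKernelS β Λ κ lo p.1 v) p.2 / C := funext fun p => by rw [deriv_div_const]
    rw [h]
    exact (continuous_deriv_ppFarKernelS₂ hβ hΛ hB₁ hκ hlo hκ'c).div_const C
  · have hfun : (fun e => wt e * deriv (fun v : ℝ => ppFarKernelS β Λ κ lo e v / C) (D - e)) =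
        fun e => (wt e * deriv (fun v : ℝ => ppFarKernelS β Λ κ lo e v) (D - e)) / C := funext fun e => by
      rw [deriv_div_const]; ring
    rw [hfun, intervalIntegral.integral_div, abs_div, abs_of_pos hC, div_le_iff₀ hC]
    refine (farS_hflat_row hβ hΛ hB₁ hB₂ hκ hκ'c hκb hκ'b ht₀ ht25 hκs hκ's hκ''s hlo hloΛ hlohi hwc' hwW' hW' hwL hD hDhi).trans (le_of_eq ?_)
    field_simp
  · rw [deriv_div_const, abs_div, abs_of_pos hC, div_mul_eq_mul_div]
    exact div_le_div_of_nonneg_right (abs_deriv_ppFarKernelS_negLevel_row hβ hΛ hB₁ hB₂ hκ hκb hκ'b hlo s hs u hu) hC.le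
  · rw [deriv_div_const]
    have he' : |e| ≤ lo := abs_le.2 ⟨he.1, he.2⟩
    exact abs_div_le_of_le (abs_deriv_ppFarKernelS_strip_le hβ hΛ hB₁ hκ hκb hκ'b hlo hloΛ he' u) hCs hC (by positivity)

include hβ hΛ hB₁ hB₂ hκb hκ'b ht₀ ht25 hlo hC in
/-- The bundle's constants are nonnegative: `0 ≤ Afl`, `0 ≤ Bfl`, `0 ≤ Mρ` (the law's `hAfl`, `hBfl`, `hMρ` rows), for `0 ≤ W`, `0 ≤ W′`. [folklore] -/
theorem ppFarKernelS_consts_nonneg {W W' : ℝ} (hW : 0 ≤ W) (hW' : 0 ≤ W') :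
    0 ≤ W * (4 * (κ₀ * (64 * B₂ + 108 * B₁ + 145) + κ₁ * (12 * B₁ + 9)) * (Λ / lo) ^ 2 +
            (κ₀ * ((6 * B₁ + 5 / 2) * (Λ / lo) + Λ / lo / (2 * (1 - t₁)) + 6 / (β * lo) + 1) + κ₁ * (1 / (2 * (1 - t₁)) + t₁ / (1 - t₁)))) / C ∧
      0 ≤ W' * (κ₀ * (64 * B₂ + 108 * B₁ + 145) + κ₁ * (12 * B₁ + 9)) * t₁ ^ 2 / (1 - t₁) ^ 2 / C ∧
      0 ≤ (32 * (κ₀ * (64 * B₂ + 120 * B₁ + 154) + κ₁ * (12 * B₁ + 9)) * (Λ / lo) ^ 3 +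
          32 * (κ₀ * ((β * lo) ^ 2 + 2) + κ₁ * (β * lo + 1)) / (β * lo) ^ 3) / C := by
  have hB10 : 0 ≤ B₁ := salmhoferB₁_nonneg hB₁
  have hB20 : 0 ≤ B₂ := (abs_nonneg _).trans (hB₂ 0)
  have hκ₀ : 0 ≤ κ₀ := (abs_nonneg _).trans (hκb 0 (left_mem_Icc.2 zero_le_one))
  have hκ₁ : 0 ≤ κ₁ := (abs_nonneg _).trans (hκ'b 0 (left_mem_Icc.2 zero_le_one))
  have h1t : 0 < 1 - t₁ := by linarith
  exact ⟨by positivity, by positivity, by positivity⟩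

end Bundle

/-! ## §2 Preliminaries of the one-calls -/

/-- **ROW `hK0s`** for the smooth far piece: `|A_s(e,u)/C| ≤ (max lo |u|)⁻¹` for `|e| ≤ lo ≤ Λ`, once `8κ₀ ≤ C` (`|P| ≤ 8·(max Λ |u|)⁻¹` on the strip, `|κ| ≤ κ₀`).
[cite: BenfattoGiulianiMastropietro2006, §2.4 (2.36)] -/
theorem farSRow_hK0s {βT Λ : ℝ} (hkβ : 0 < βT) (hkΛ : 0 < Λ) {sκ : ℝ → ℝ} {κ₀ : ℝ} (hkκb : ∀ t ∈ Icc (0 : ℝ) 1, |sκ t| ≤ κ₀) {lo C : ℝ} (hlo0 : 0 < lo)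
    (hkloΛ : lo ≤ Λ) (hkC : 0 < C) (hC8 : 8 * κ₀ ≤ C) :
    ∀ e ∈ Icc (-lo) lo, ∀ u, |ppFarKernelS βT Λ sκ lo e u / C| ≤ (max lo |u|)⁻¹ := fun e he u => by
  have hκ₀ : 0 ≤ κ₀ := (abs_nonneg _).trans (hkκb 0 (left_mem_Icc.2 zero_le_one))
  have heΛ : |e| ≤ Λ := (abs_le.2 ⟨he.1, he.2⟩).trans hkloΛ
  have hP := abs_ppTrueKernel_strip_le_inv_max hkβ hkΛ heΛ u
  have hr := ppSmoothRatio_mem_Ioo hlo0 e u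
  have hk := hkκb _ ⟨hr.1.le, hr.2.le⟩
  have hm0 : 0 < max lo |u| := lt_max_of_lt_left hlo0
  have hmm : (max Λ |u|)⁻¹ ≤ (max lo |u|)⁻¹ := by
    rw [inv_le_inv₀ (lt_max_of_lt_left hkΛ) hm0]; exact max_le_max hkloΛ le_rfl
  unfold ppFarKernelS
  rw [abs_div, abs_of_pos hkC, div_le_iff₀ hkC, abs_mul]
  calc |ppTrueKernel βT Λ e u| * |sκ (ppSmoothRatio lo e u)| ≤ 8 * (max Λ |u|)⁻¹ * κ₀ := mul_le_mul hP hk (abs_nonneg _) (by positivity)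
    _ ≤ 8 * (max lo |u|)⁻¹ * κ₀ := by gcongr
    _ = 8 * κ₀ * (max lo |u|)⁻¹ := by ring
    _ ≤ C * (max lo |u|)⁻¹ := mul_le_mul_of_nonneg_right hC8 (inv_nonneg.2 hm0.le)
    _ = (max lo |u|)⁻¹ * C := mul_comm _ _

/-- **Row constants of the concrete split profile for `A_s`**: with `κ₀ = 1`, `κ₁ = 6/t₁`, `κ₂ = 8388608/t₁²`, the sum `Cᴬ := C₀ᴬ + C₁ᴬ + C₂ᴬ + Cˢ` is positive and
`C₀ᴬ, C₁ᴬ, C₂ᴬ, Cˢ ≤ Cᴬ` (`0 ≤ B₁, B₂, B₃`, `0 < t₁`). [folklore] -/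
theorem ppSplit_rowConstsFarS {B₁ B₂ B₃ t₁ : ℝ} (hB₁ : 0 ≤ B₁) (hB₂ : 0 ≤ B₂) (hB₃ : 0 ≤ B₃) (ht₀ : 0 < t₁) :
    0 < (1 * (12 * B₁ + 9) +
      (1 * (64 * B₂ + 108 * B₁ + 145) + (6 / t₁) * (12 * B₁ + 9)) +
      (1 * (256 * B₃ + 800 * B₂ + 2592 * B₁ + 1630) + 2 * (6 / t₁) * (64 * B₂ + 108 * B₁ + 145) + (12 * B₁ + 9) * ((8388608 / t₁ ^ 2) + 3 * (6 / t₁))) +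
      (1 * (128 * B₁ + 72) + 8 * (6 / t₁))) ∧
    1 * (12 * B₁ + 9) ≤ (1 * (12 * B₁ + 9) +
      (1 * (64 * B₂ + 108 * B₁ + 145) + (6 / t₁) * (12 * B₁ + 9)) +
      (1 * (256 * B₃ + 800 * B₂ + 2592 * B₁ + 1630) + 2 * (6 / t₁) * (64 * B₂ + 108 * B₁ + 145) + (12 * B₁ + 9) * ((8388608 / t₁ ^ 2) + 3 * (6 / t₁))) +
      (1 * (128 * B₁ + 72) + 8 * (6 / t₁))) ∧
    1 * (64 * B₂ + 108 * B₁ + 145) + (6 / t₁) * (12 * B₁ + 9) ≤ (1 * (12 * B₁ + 9) +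
      (1 * (64 * B₂ + 108 * B₁ + 145) + (6 / t₁) * (12 * B₁ + 9)) +
      (1 * (256 * B₃ + 800 * B₂ + 2592 * B₁ + 1630) + 2 * (6 / t₁) * (64 * B₂ + 108 * B₁ + 145) + (12 * B₁ + 9) * ((8388608 / t₁ ^ 2) + 3 * (6 / t₁))) +
      (1 * (128 * B₁ + 72) + 8 * (6 / t₁))) ∧
    1 * (256 * B₃ + 800 * B₂ + 2592 * B₁ + 1630) + 2 * (6 / t₁) * (64 * B₂ + 108 * B₁ + 145) + (12 * B₁ + 9) * ((8388608 / t₁ ^ 2) + 3 * (6 / t₁)) ≤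
      (1 * (12 * B₁ + 9) +
      (1 * (64 * B₂ + 108 * B₁ + 145) + (6 / t₁) * (12 * B₁ + 9)) +
      (1 * (256 * B₃ + 800 * B₂ + 2592 * B₁ + 1630) + 2 * (6 / t₁) * (64 * B₂ + 108 * B₁ + 145) + (12 * B₁ + 9) * ((8388608 / t₁ ^ 2) + 3 * (6 / t₁))) +
      (1 * (128 * B₁ + 72) + 8 * (6 / t₁))) ∧
    1 * (128 * B₁ + 72) + 8 * (6 / t₁) ≤ (1 * (12 * B₁ + 9) +
      (1 * (64 * B₂ + 108 * B₁ + 145) + (6 / t₁) * (12 * B₁ + 9)) +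
      (1 * (256 * B₃ + 800 * B₂ + 2592 * B₁ + 1630) + 2 * (6 / t₁) * (64 * B₂ + 108 * B₁ + 145) + (12 * B₁ + 9) * ((8388608 / t₁ ^ 2) + 3 * (6 / t₁))) +
      (1 * (128 * B₁ + 72) + 8 * (6 / t₁))) := by
  have h0 : 0 < 1 * (12 * B₁ + 9) := by positivity
  have h1 : 0 ≤ 1 * (64 * B₂ + 108 * B₁ + 145) + (6 / t₁) * (12 * B₁ + 9) := by positivity
  have h2 : 0 ≤ 1 * (256 * B₃ + 800 * B₂ + 2592 * B₁ + 1630) + 2 * (6 / t₁) * (64 * B₂ + 108 * B₁ + 145) + (12 * B₁ + 9) * ((8388608 / t₁ ^ 2) + 3 * (6 / t₁)) := by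
    positivity
  have h3 : 0 ≤ 1 * (128 * B₁ + 72) + 8 * (6 / t₁) := by positivity
  exact ⟨by linarith, by linarith, by linarith, by linarith, by linarith⟩


end Summit.HubbardSuperconductivity.HubbardSuperconductivity.Theorems.C4a

end
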